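/-
Copyright (c) 2026. All rights reserved.
Released under Apache 2.0 license as described in the file LICENSE.
Authors: abc-iut cell, seat abc-iut-w6-d024 (gen 0; block C / W6 cone prover, node `AbsTopIII:Cor4.5(iv)`).
-/
import Literature.AnabelianGeometry.AbsoluteAnabelian.ArchimedeanLogFrobeniusModelTM
import Literature.AnabelianGeometry.AbsoluteAnabelian.ArchimedeanHolFieldFunctorGeometricRC
import Literature.AnabelianGeometry.AbsoluteAnabelian.AbsTopIII.AutHolLogFrobeniusGaloisModel
import HarnessLib

/-!
# [AbsTopIII] Cor 4.5 (iv) AT THE ARCHIMEDEAN MODEL from ONE object — no id-rigidity; the side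
# condition is exactly necessary

S. Mochizuki, *Topics in absolute anabelian geometry III*, §4, Cor 4.5 (iv) p. 109 l. 6–11 ("The diagram
of categories `𝒟_{≤2}` does not admit a structure of core on `𝒟_{≤1}` which … is compatible with … the
observable `𝔖_log` of (iii). Moreover, the telecore structure `𝔗_LH` of (ii), the contact structure
`ℋ_LH` of (ii), and the observable `𝔖_log` of (iii) are not simultaneously compatible"), with its proof
p. 110 l. 22–39 ("… we obtain a natural transformation `ζ'₁ = ζ₂ ∘ ζ₁ ∘ ζ'₀ : λ^× ∘ id_⋎ → λ^× ∘ id_⋎` —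
which … must coincide with the 'identity homotopy' … by writing out explicitly the meaning of such an
equality `ζ'₁ = id`, we … obtain a contradiction to Lemma 4.4. … The proof of the second incompatibility
… is entirely similar"), Lemma 4.4 p. 107; kurims manuscript (lit key `paper:url-5493eb38cbb7`, read on
the page; bib key `MochizukiAbsTopIII2015`).  PROOF-ONLY companion (abc-iut cell, node
`AbsTopIII:Cor4.5(iv)`; no declaration of a notion) of abc-iut-L4-t10's statement file
`AbsTopIII/AutHolLogFrobenius.lean` (`Cor_4_5_iv Δ τ := Δ.IncompatibleStmt ∧ Δ.TelecoreIncompatibleStmt τ`).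

## What is proved

Every landed model theorem that yields Cor 4.5 (iv) — `AbsTopIII.cor_4_5_arch`, `cor_4_5_arch_TM`,
`HolRS.cor_4_5_geometric`, `HolRS.cor_4_5_geometricRC`, `cor_4_5_arch_ofGaloisCategory` — does so through
the FULL Cor 4.5 and therefore carries the hypothesis `IsIdRigid EA` (Prop 4.2 (i), "from the slimness
assertion of Lemma 4.3"), which the printed proof of (iv) does NOT use: (iv) rests on Lemma 4.4 and on
the existence of an object only (abc-iut-L4-t10's `cor_4_5_iv_of_lemma44 τ ι hι a₀ h44`); id-rigidity
enters Cor 4.5 through (v) alone.  Accordingly, over EVERY interface datum `𝔄 : AutHolFieldFunctor`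
(Cor 2.7 (e) + functoriality) and for the Def 4.1 input data `archLogFrobeniusData 𝔄` (`T = TF`,
abc-iut-L4-t10) / `archLogFrobeniusDataTM 𝔄` (`T = TM`, abc-iut-w5-d226) with their first-row telecore
data `⟨φ_LH, unitor, η_LH⟩`:

* `AbsTopIII.cor_4_5_iv_arch 𝔄 X₀`, `AbsTopIII.cor_4_5_iv_arch_TM 𝔄 X₀` — **Cor 4.5 (iv) from ONE object
  `X₀` of `EA`** (orientation `rfl`, Lemma 4.4 = `arch_lemma44Property` / `archTM_lemma44Property`,
  `a₀ := κ_LH(X₀)`);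
* `AbsTopIII.cor_4_5_iv_arch_iff_nonempty`, `…_TM_iff_nonempty` — **the side condition is EXACTLY
  necessary**: `Cor_4_5_iv (archLogFrobeniusData 𝔄) (archTelecoreData 𝔄) ↔ Nonempty 𝔄.EA`.  The
  direction `→` is the generic `LogFrobeniusData.nonempty_of_incompatibleStmt`: for input data `Δ`
  whose categories `𝒳₁`, `𝒳`, `𝒩` are all EMPTY, the typed first incompatibility `IncompatibleStmt`
  FAILS — the family of homotopies on `𝒟_{≤3}` with boundary set ALL co-verticial pairs (`covert`, §0)
  and every homotopy the unique (empty) natural transformation is a compatible "core" in the typed sense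
  (built inside the proof of `LogFrobeniusData.not_incompatibleStmt_of_isEmpty`); at the model, `EA = ∅`
  empties `𝒞^hol_TF`, `𝒞^hol_TM`, `𝒞^hol_TH` (each object carries its structure-orbispace `𝕏 ∈ Ob(EA)`);
* specialisations with the residual hypothesis of the GEOMETRIC models gone for (iv):
  `HolRS.cor_4_5_iv_geometric Q X₀` (abc-iut-L4-t14's holomorphic geometric `EA^hol_RS(Q)` for EVERY
  admissibility predicate `Q` — print's "elliptically admissible hyperbolic orbicurves over CAF's" is a
  value of the parameter — given one object), `HolRS.cor_4_5_iv_geometric_of X hX` (from a connected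
  Riemann surface satisfying `Q`), `HolRS.cor_4_5_iv_geometricRC` (the RC-holomorphic widening),
  `HolRS.cor_4_5_iv_geometric_top` (no restriction: the complex plane is an object — hypothesis-free),
  and `AbsTopIII.cor_4_5_iv_arch_ofGaloisCategory G X₀` (the Galois-category instance `EA := B(Π)` for ANY
  topological group `Π` and one finite continuous `Π`-set — NO slimness).

HONEST SCOPE.  This discharges the typed (iv) at the tree's models of the Def 4.1 data; the interface `𝔄`
on the geometric carriers with the Cor 2.7 ALGORITHMS (reconstruction of `𝒜_p`) is abc-iut-L4-t14's MODEL
(`𝒜_𝕏 := ℂ` the multiplier field), not a reconstruction; the orbi case is not constructed there.  The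
universal closure `∀ Δ τ, Cor_4_5_iv Δ τ` over abstract input data is FALSE (this file's
`LogFrobeniusData.not_incompatibleStmt_of_isEmpty` at empty data; FACT-LIST row F-0309 is the F-lane's) —
(iv) is a statement about the data of Def 4.1, and that is what is proved.  Refereed pre-IUT anabelian
geometry; nothing here bears on [IUTchIII] Cor. 3.12 or takes a side; typed ≠ proved elsewhere;
model ≠ reconstruction.
-/

set_option autoImplicit false

namespace Literature.AnabelianGeometry.AbsoluteAnabelian

open _root_.CategoryTheory _root_.Quiver

universe u

/-! ### Empty input data: the typed first incompatibility fails (the side condition is necessary) -/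

namespace LogFrobeniusData

variable (Δ : LogFrobeniusData.{u})

/-- Natural transformations out of a functor on an EMPTY category form a subsingleton. [folklore] -/
private theorem subsingleton_natTrans_of_isEmpty {C : Type*} [Category C] {D : Type*} [Category D]
    [IsEmpty C] (F G : C ⥤ D) : Subsingleton (F ⟶ G) :=
  ⟨fun _ _ => NatTrans.ext (funext fun x => isEmptyElim x)⟩

/-- When `𝒳₁`, `𝒳` and `𝒩` are empty, every category of the diagram `𝒟_{≤3}` (presented as `𝒟_{≤2}`
extended by the observation vertex `𝒩`) is empty. [cite: MochizukiAbsTopIII2015, Corollary 3.6 (iii) p.80] -/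
theorem isEmpty_sub3_obj [IsEmpty Δ.X₁] [IsEmpty Δ.X] [IsEmpty Δ.N] (a : logObsShape.{u}.Vertex) :
    IsEmpty (Δ.sub3.obj a) := by
  rcases a with ⟨v, hv⟩ | _
  · rcases v with n | _ | _ | _ | _ | _
    · exact (inferInstance : IsEmpty Δ.X₁)
    · exact (inferInstance : IsEmpty Δ.X)
    · exact absurd hv (by simp [LFVertex.row])
    · exact absurd hv (by simp [LFVertex.row])
    · exact absurd hv (by simp [LFVertex.row])
    · exact absurd hv (by simp [LFVertex.row])
  · exact (inferInstance : IsEmpty Δ.N)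

/-- **Empty input data carry a "core compatible with `𝔖_log`" in the typed sense**, so the typed first
incompatibility `IncompatibleStmt` FAILS for them: the family of homotopies on `𝒟_{≤3}` whose boundary
set is the set of ALL co-verticial pairs (`Covert`, symmetrically saturated, §0) and whose homotopies are
the unique natural transformations between functors on empty categories contains an isomorphism for
every pair `([id_{⋎+1}], [id_⋎]∘[log])` and is (vacuously) pinned to `ι_{log,⋎}`, `ι_×`.  This is the
necessity half of the side condition "an object exists" under which Cor 3.6 (iv) / 4.5 (iv) is proved
(`incompatibleStmt_of_lemma34` / `incompatibleStmt_of_lemma44` take an object `x₀`).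
[cite: MochizukiAbsTopIII2015, Corollary 4.5 (iv) p.109] -/
theorem not_incompatibleStmt_of_isEmpty [IsEmpty Δ.X₁] [IsEmpty Δ.X] [IsEmpty Δ.N] :
    ¬ Δ.IncompatibleStmt := by
  haveI hE : ∀ a : logObsShape.{u}.Vertex, IsEmpty (Δ.sub3.obj a) := Δ.isEmpty_sub3_obj
  haveI hS : ∀ {a b : logObsShape.{u}.Vertex} (F G : Δ.sub3.obj a ⥤ Δ.sub3.obj b),
      Subsingleton (F ⟶ G) := fun F G => subsingleton_natTrans_of_isEmpty F G
  -- the trivial family: all co-verticial pairs, empty natural transformations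
  let K : Δ.sub3.HomotopyFamily :=
    { E := covert
      isSaturated := isSymmSaturated_covert.toIsSaturated
      η := fun a _ p q _ =>
        { app := fun x => isEmptyElim x
          naturality := fun x => isEmptyElim x }
      η_refl := fun _ _ _ _ => Subsingleton.elim _ _
      η_trans := fun _ _ _ _ _ _ _ => Subsingleton.elim _ _
      η_whisker := fun _ _ _ _ _ _ _ _ _ => Subsingleton.elim _ _ }
  intro h
  apply h
  refine ⟨K, fun n => ⟨trivial, ⟨⟨K.η (p := corePathLog n) (q := corePathId n) trivial,
    Subsingleton.elim _ _, Subsingleton.elim _ _⟩⟩⟩, ?_, fun n => ⟨trivial, fun x => isEmptyElim x⟩⟩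
  -- `LogPinned`, type-(2) clause: vacuous in either orientation of `ι_×`
  split <;> exact ⟨trivial, fun x => isEmptyElim x⟩

/-- Consequently the typed first incompatibility requires SOME object: if `IncompatibleStmt` holds then
`𝒳₁`, `𝒳`, `𝒩` are not all empty. [cite: MochizukiAbsTopIII2015, Corollary 4.5 (iv) p.109] -/
theorem nonempty_of_incompatibleStmt (h : Δ.IncompatibleStmt) :
    Nonempty Δ.X₁ ∨ Nonempty Δ.X ∨ Nonempty Δ.N := by
  by_contra hne
  simp only [not_or, not_nonempty_iff] at hne
  obtain ⟨h₁, h₂, h₃⟩ := hne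
  exact Δ.not_incompatibleStmt_of_isEmpty h

end LogFrobeniusData

/-! ### Cor 4.5 (iv) at the archimedean model, `T = TF`, from ONE object of `EA`; the iff -/

namespace AbsTopIII

variable (𝔄 : AutHolFieldFunctor.{u})

/-- **[AbsTopIII] Cor 4.5 (iv) AT THE ARCHIMEDEAN MODEL (`T = TF`) from ONE object of `EA`**: both
incompatibilities — "`𝒟_{≤2}` does not admit a structure of core on `𝒟_{≤1}` … compatible with … `𝔖_log`"
and "`𝔗_LH`, `ℋ_LH`, `𝔖_log` are not simultaneously compatible" — for the Def 4.1 input data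
`archLogFrobeniusData 𝔄` with its first-row telecore data `⟨φ_LH, unitor, η_LH⟩`, over EVERY interface datum
`𝔄` (Cor 2.7 (e) + functoriality), given an object `𝕏₀ ∈ Ob(EA)`.  Inputs, as in print (p. 110 l. 22–39):
the orientation `ι_× : λ^∼ → λ^×` (`rfl`), Lemma 4.4 at the model (abc-iut-L4-t10's
`arch_lemma44Property`: "the non-injectivity of `k~ ↠ k^×`"), and the object `κ_LH(𝕏₀)` of `LinHol`; NO
id-rigidity of `EA` (that input of `cor_4_5_arch` serves (v) only).
[cite: MochizukiAbsTopIII2015, Corollary 4.5 (iv) p.109] -/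
theorem cor_4_5_iv_arch (X₀ : 𝔄.EA) :
    Literature.AnabelianGeometry.AbsoluteAnabelian.AbsTopIII.Cor_4_5_iv (archLogFrobeniusData 𝔄)
      (archTelecoreData 𝔄) :=
  cor_4_5_iv_of_lemma44 (Δ := archLogFrobeniusData 𝔄) (archTelecoreData 𝔄) (HolTFPair.iotaTimes 𝔄) rfl
    ((LinHol.κLH 𝔄).obj X₀) (arch_lemma44Property 𝔄)

/-- The two printed sentences of (iv) separately, at the model: no compatible core on `𝒟_{≤1}`, and no
simultaneous compatibility of `𝔗_LH`, `ℋ_LH`, `𝔖_log`. [cite: MochizukiAbsTopIII2015, Corollary 4.5 (iv) p.109] -/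
theorem cor_4_5_iv_arch_clauses (X₀ : 𝔄.EA) :
    (archLogFrobeniusData 𝔄).IncompatibleStmt ∧
      (archLogFrobeniusData 𝔄).TelecoreIncompatibleStmt (archTelecoreData 𝔄) :=
  cor_4_5_iv_arch 𝔄 X₀

/-- With `EA` empty, `𝒞^hol_TF` is empty (every pair carries its structure-orbispace `𝕏 ∈ Ob(EA)`).
[cite: MochizukiAbsTopIII2015, Definition 4.1 (ii) p.102] -/
theorem isEmpty_holTFPair [IsEmpty 𝔄.EA] : IsEmpty (HolTFPair 𝔄) := ⟨fun P => isEmptyElim P.X⟩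

/-- With `EA` empty, `𝒞^hol_TH` is empty. [cite: MochizukiAbsTopIII2015, Definition 4.1 (ii) p.102] -/
theorem isEmpty_holTHPair [IsEmpty 𝔄.EA] : IsEmpty (HolTHPair 𝔄) := ⟨fun P => isEmptyElim P.X⟩

/-- With `EA` empty, `𝒞^hol_T` (`T ∈ {TM, TLG, TCG}`) is empty. [cite: MochizukiAbsTopIII2015, Definition 4.1 (ii) p.102] -/
theorem isEmpty_holMonoidPair [IsEmpty 𝔄.EA] (T : ArchPairType) : IsEmpty (HolMonoidPair 𝔄 T) :=
  ⟨fun P => isEmptyElim P.X⟩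

/-- **Necessity of the object**: if the typed first incompatibility holds for the archimedean model then
`EA` has an object (with `EA = ∅` the categories `𝒳₁ = 𝒳 = 𝒞^hol_TF` and `𝒩 = 𝒞^hol_TH` of `𝒟_{≤3}`
are empty and the trivial family of homotopies is a compatible core).
[cite: MochizukiAbsTopIII2015, Corollary 4.5 (iv) p.109] -/
theorem nonempty_EA_of_incompatibleStmt_arch (h : (archLogFrobeniusData 𝔄).IncompatibleStmt) :
    Nonempty 𝔄.EA := by
  by_contra hne
  haveI : IsEmpty 𝔄.EA := not_nonempty_iff.mp hne
  haveI : IsEmpty (archLogFrobeniusData 𝔄).X₁ := isEmpty_holTFPair 𝔄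
  haveI : IsEmpty (archLogFrobeniusData 𝔄).X := isEmpty_holTFPair 𝔄
  haveI : IsEmpty (archLogFrobeniusData 𝔄).N := isEmpty_holTHPair 𝔄
  exact (archLogFrobeniusData 𝔄).not_incompatibleStmt_of_isEmpty h

/-- **Cor 4.5 (iv) at the archimedean model (`T = TF`) holds IFF `EA` has an object** — the side
condition of `cor_4_5_iv_arch` is exactly necessary. [cite: MochizukiAbsTopIII2015, Corollary 4.5 (iv) p.109] -/
theorem cor_4_5_iv_arch_iff_nonempty :
    Literature.AnabelianGeometry.AbsoluteAnabelian.AbsTopIII.Cor_4_5_iv (archLogFrobeniusData 𝔄)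
      (archTelecoreData 𝔄) ↔ Nonempty 𝔄.EA :=
  ⟨fun h => nonempty_EA_of_incompatibleStmt_arch 𝔄 h.1, fun ⟨X₀⟩ => cor_4_5_iv_arch 𝔄 X₀⟩

/-! ### The same for `T = TM` (abc-iut-w5-d226's twin data `archLogFrobeniusDataTM`) -/

/-- **[AbsTopIII] Cor 4.5 (iv) AT THE ARCHIMEDEAN MODEL (`T = TM`, `𝒳 = 𝒞^hol_TM`) from ONE object of
`EA`**, over every interface datum: orientation `rfl`, Lemma 4.4 = abc-iut-w5-d226's
`archTM_lemma44Property` (reduced to the `TF` composite along the finite étale `a_𝕏`), object `κ_LH(𝕏₀)`; no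
id-rigidity. [cite: MochizukiAbsTopIII2015, Corollary 4.5 (iv) p.109] -/
theorem cor_4_5_iv_arch_TM (X₀ : 𝔄.EA) :
    Literature.AnabelianGeometry.AbsoluteAnabelian.AbsTopIII.Cor_4_5_iv (archLogFrobeniusDataTM 𝔄)
      (archTelecoreDataTM 𝔄) :=
  cor_4_5_iv_of_lemma44 (Δ := archLogFrobeniusDataTM 𝔄) (archTelecoreDataTM 𝔄)
    (HolMonoidPair.iotaTimesTM 𝔄) rfl ((LinHol.κLH 𝔄).obj X₀) (archTM_lemma44Property 𝔄)

/-- Necessity of the object for the `TM` model. [cite: MochizukiAbsTopIII2015, Corollary 4.5 (iv) p.109] -/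
theorem nonempty_EA_of_incompatibleStmt_arch_TM (h : (archLogFrobeniusDataTM 𝔄).IncompatibleStmt) :
    Nonempty 𝔄.EA := by
  by_contra hne
  haveI : IsEmpty 𝔄.EA := not_nonempty_iff.mp hne
  haveI : IsEmpty (archLogFrobeniusDataTM 𝔄).X₁ := isEmpty_holMonoidPair 𝔄 .TM
  haveI : IsEmpty (archLogFrobeniusDataTM 𝔄).X := isEmpty_holMonoidPair 𝔄 .TM
  haveI : IsEmpty (archLogFrobeniusDataTM 𝔄).N := isEmpty_holTHPair 𝔄
  exact (archLogFrobeniusDataTM 𝔄).not_incompatibleStmt_of_isEmpty h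

/-- **Cor 4.5 (iv) at the `TM` model holds IFF `EA` has an object.** [cite: MochizukiAbsTopIII2015, Corollary 4.5 (iv) p.109] -/
theorem cor_4_5_iv_arch_TM_iff_nonempty :
    Literature.AnabelianGeometry.AbsoluteAnabelian.AbsTopIII.Cor_4_5_iv (archLogFrobeniusDataTM 𝔄)
      (archTelecoreDataTM 𝔄) ↔ Nonempty 𝔄.EA :=
  ⟨fun h => nonempty_EA_of_incompatibleStmt_arch_TM 𝔄 h.1, fun ⟨X₀⟩ => cor_4_5_iv_arch_TM 𝔄 X₀⟩

/-! ### The Galois-category instance `EA := B(Π)`: no slimness needed for (iv) -/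

/-- **Cor 4.5 (iv) at the Galois-category instance of the interface** (`EA := B(Π)`, abc-iut-L4-t10's
`AutHolFieldFunctor.ofGaloisCategory`) for ANY topological group `Π` and one finite continuous `Π`-set
`X₀` — contrast `cor_4_5_arch_ofGaloisCategory`, which needs `Π` profinite and SLIM (Lemma 4.3) because
it proves (v) as well. [cite: MochizukiAbsTopIII2015, Corollary 4.5 (iv) p.109] -/
theorem cor_4_5_iv_arch_ofGaloisCategory (G : Type) [Group G] [TopologicalSpace G] (X₀ : Literature.AlgebraicGeometry.Frobenioids.BCat G) :
    Literature.AnabelianGeometry.AbsoluteAnabelian.AbsTopIII.Cor_4_5_iv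
      (archLogFrobeniusData (AutHolFieldFunctor.ofGaloisCategory G))
      (archTelecoreData (AutHolFieldFunctor.ofGaloisCategory G)) :=
  cor_4_5_iv_arch _ (AutHolFieldFunctor.objOfBCat G X₀)

end AbsTopIII

/-! ### The geometric models: (iv) for EVERY admissibility predicate `Q`, given one object -/

namespace HolRS

section Holomorphic

variable (Q : ObjectProperty HolRS)

/-- **[AbsTopIII] Cor 4.5 (iv) over GEOMETRIC carriers, for every admissibility predicate `Q`**: for the
archimedean log-Frobenius data built over abc-iut-L4-t14's holomorphic geometric instance `EA^hol_RS(Q)`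
(connected Riemann surfaces satisfying `Q`, holomorphic finite étale maps, `𝒜_𝕏 = ℂ`), (iv) holds as soon
as `Q` has an object — the hypothesis `IsIdRigid EA^hol_RS(Q)` of `cor_4_5_geometric` is NOT needed for
(iv). [cite: MochizukiAbsTopIII2015, Corollary 4.5 (iv) p.109] -/
theorem cor_4_5_iv_geometric (X₀ : (geometricAutHolFieldFunctor Q).EA) :
    Literature.AnabelianGeometry.AbsoluteAnabelian.AbsTopIII.Cor_4_5_iv
      (archLogFrobeniusData (geometricAutHolFieldFunctor Q))
      (archTelecoreData (geometricAutHolFieldFunctor Q)) :=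
  AbsTopIII.cor_4_5_iv_arch _ X₀

/-- The same from a connected Riemann surface `𝕏` satisfying `Q`. [cite: MochizukiAbsTopIII2015, Corollary 4.5 (iv) p.109] -/
theorem cor_4_5_iv_geometric_of (X : HolRS) (hX : Q X) :
    Literature.AnabelianGeometry.AbsoluteAnabelian.AbsTopIII.Cor_4_5_iv
      (archLogFrobeniusData (geometricAutHolFieldFunctor Q))
      (archTelecoreData (geometricAutHolFieldFunctor Q)) :=
  cor_4_5_iv_geometric Q ⟨X, hX⟩

/-- **(iv) over geometric carriers holds IFF the admissibility predicate `Q` is satisfied by some connected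
Riemann surface.** [cite: MochizukiAbsTopIII2015, Corollary 4.5 (iv) p.109] -/
theorem cor_4_5_iv_geometric_iff :
    Literature.AnabelianGeometry.AbsoluteAnabelian.AbsTopIII.Cor_4_5_iv
      (archLogFrobeniusData (geometricAutHolFieldFunctor Q))
      (archTelecoreData (geometricAutHolFieldFunctor Q)) ↔ ∃ X : HolRS, Q X :=
  (AbsTopIII.cor_4_5_iv_arch_iff_nonempty _).trans
    ⟨fun ⟨X⟩ => ⟨X.obj, X.property⟩, fun ⟨X, hX⟩ => ⟨⟨X, hX⟩⟩⟩

/-- **Hypothesis-free instance**: with no restriction on the carriers (`Q = ⊤`; the complex plane is an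
object) Cor 4.5 (iv) holds outright for the archimedean data over geometric carriers.
[cite: MochizukiAbsTopIII2015, Corollary 4.5 (iv) p.109] -/
theorem cor_4_5_iv_geometric_top :
    Literature.AnabelianGeometry.AbsoluteAnabelian.AbsTopIII.Cor_4_5_iv
      (archLogFrobeniusData (geometricAutHolFieldFunctor ⊤))
      (archTelecoreData (geometricAutHolFieldFunctor ⊤)) :=
  cor_4_5_iv_geometric_of ⊤ complexPlane trivial

/-- The `T = TM` data over geometric carriers: (iv) from one object of `Q`. [cite: MochizukiAbsTopIII2015, Corollary 4.5 (iv) p.109] -/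
theorem cor_4_5_iv_geometric_TM (X₀ : (geometricAutHolFieldFunctor Q).EA) :
    Literature.AnabelianGeometry.AbsoluteAnabelian.AbsTopIII.Cor_4_5_iv
      (archLogFrobeniusDataTM (geometricAutHolFieldFunctor Q))
      (archTelecoreDataTM (geometricAutHolFieldFunctor Q)) :=
  AbsTopIII.cor_4_5_iv_arch_TM _ X₀

end Holomorphic

section RCHolomorphic

variable (Q : ObjectProperty RC)

/-- **Cor 4.5 (iv) over the RC-holomorphic geometric `EA`** (abc-iut-L4-t14's print-faithful widening:
RC-holomorphic finite étale maps, `𝒜_φ = id / conj`), for every `Q`, from one object; no id-rigidity.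
[cite: MochizukiAbsTopIII2015, Corollary 4.5 (iv) p.109] -/
theorem cor_4_5_iv_geometricRC (X₀ : (geometricAutHolFieldFunctorRC Q).EA) :
    Literature.AnabelianGeometry.AbsoluteAnabelian.AbsTopIII.Cor_4_5_iv
      (archLogFrobeniusData (geometricAutHolFieldFunctorRC Q))
      (archTelecoreData (geometricAutHolFieldFunctorRC Q)) :=
  AbsTopIII.cor_4_5_iv_arch _ X₀

/-- The same from a connected Riemann surface satisfying `Q`. [cite: MochizukiAbsTopIII2015, Corollary 4.5 (iv) p.109] -/
theorem cor_4_5_iv_geometricRC_of (X : RC) (hX : Q X) :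
    Literature.AnabelianGeometry.AbsoluteAnabelian.AbsTopIII.Cor_4_5_iv
      (archLogFrobeniusData (geometricAutHolFieldFunctorRC Q))
      (archTelecoreData (geometricAutHolFieldFunctorRC Q)) :=
  cor_4_5_iv_geometricRC Q ⟨X, hX⟩

/-- (iv) over the RC-holomorphic geometric `EA` holds IFF `Q` has an object. [cite: MochizukiAbsTopIII2015, Corollary 4.5 (iv) p.109] -/
theorem cor_4_5_iv_geometricRC_iff :
    Literature.AnabelianGeometry.AbsoluteAnabelian.AbsTopIII.Cor_4_5_iv
      (archLogFrobeniusData (geometricAutHolFieldFunctorRC Q))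
      (archTelecoreData (geometricAutHolFieldFunctorRC Q)) ↔ ∃ X : RC, Q X :=
  (AbsTopIII.cor_4_5_iv_arch_iff_nonempty _).trans
    ⟨fun ⟨X⟩ => ⟨X.obj, X.property⟩, fun ⟨X, hX⟩ => ⟨⟨X, hX⟩⟩⟩

/-- Hypothesis-free instance over the RC-holomorphic carriers (`Q = ⊤`, the complex plane).
[cite: MochizukiAbsTopIII2015, Corollary 4.5 (iv) p.109] -/
theorem cor_4_5_iv_geometricRC_top :
    Literature.AnabelianGeometry.AbsoluteAnabelian.AbsTopIII.Cor_4_5_iv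
      (archLogFrobeniusData (geometricAutHolFieldFunctorRC ⊤))
      (archTelecoreData (geometricAutHolFieldFunctorRC ⊤)) :=
  cor_4_5_iv_geometricRC_of ⊤ ⟨complexPlane⟩ trivial

end RCHolomorphic

end HolRS

end Literature.AnabelianGeometry.AbsoluteAnabelian
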